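import Literature.Computability.QuantumComplexity.ADHMachine
import HarnessLib

/-!
# The co-validity walk: an `FP` predicate forcing the Hadamard coins

Machine ingredient of the proof of the named fact
`Literature.Computability.QuantumComplexity.BQP_subset_AWPP` (`CountingSimulation.lean`;
Fortnow–Rogers 1999, Thm. 3.1 / Lemma 3.2: `BQP ⊆ AWPP`, in Fenner's one-`GapP`-function form,
Fenner 2003, Cor. 3.2), continuing the Adleman–DeMarrais–Huang path-pair machine of
`ADHMachine.lean` (walk records `rec6`, one round `roundF`, the clocked walk `passF`).

The `GapP` function of Fortnow–Rogers (Lemma 3.2: "there is a `GapP` function `f` and a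
polynomial-time computable `g(x) = 5^{2t}` … `Pr[M accepts x] = f(x)/g(x)`") is, for the tree's
Clifford+`T` circuits, the path-pair count `W = 4𝔄 + 3𝔅` of `CliffordTPathSums.lean` divided by
`8 · 2^h`, `h` the number of Hadamard gates of the circuit (`hCount`): `1/2 + W/(8·2^h)` is the
acceptance probability up to `(3√2 - 4)/8 < 0.033`. To realise the factor `2^{-h}` inside a
witness count of polynomial length one needs a block of `μ` coins (`μ` = number of gates) of
which exactly `2^{μ - h}` values are accepted. This file supplies that block as a polynomial-time
predicate, the **co-validity walk**: reading one coin per gate, the coin must be `0` at every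
Hadamard gate and is free at every other gate (dual to the validity flag of `ADH.tStep`, which
forces the coins of the *non*-branching gates):

* `coValid gs cs` — the Boolean co-validity of a coin list, `cnt_coValid`:
  `#{u ∈ {0,1}^μ | coValid gs u} = 2^{μ - h}`, `coValid_append` (only the first `μ` coins matter);
* `cvT`, `coR`, `coRoundF` — one round on a walk record of `ADHMachine.lean` (same six fields,
  label and phase untouched, the flag cleared by a coin `1` on an `H` gate), in `FP` with constant
  growth and the first field kept, so that `coPassF = coRoundF^{|d|}` is in `FP`
  (`iterate_mem_FP_of_growth`) and walks the whole gate list (`iterate_coRoundF`);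
* `co1F F` — the co-walk on `⟨x, y⟩` from the first record `rec1F F` of `ADHMachine.lean`:
  `co1F_boolPair` (flag `coValid`, unread coins `y.drop μ`), and the two read-outs used by the
  counting argument: the flag `coFlagF F` and the coin-dropping map
  `dropWalkF F : ⟨x, y⟩ ↦ ⟨x, y.drop μ⟩` (`dropWalkF_boolPair`).

## References

* L. Fortnow, J. Rogers, *Complexity limitations on quantum computation*, J. Comput. System Sci.
  59 (1999) 240–252, §3, Thm. 3.1 and Lemma 3.2 (the `GapP` function of a BQP machine).
* S. Fenner, *PP-lowness and a simple definition of AWPP*, Theory Comput. Syst. 36 (2003)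
  199–212, Cor. 3.2 (one `GapP` function, dyadic denominators).
* L. M. Adleman, J. DeMarrais, M.-D. A. Huang, *Quantum computability*, SIAM J. Comput. 26 (1997),
  §6, Lemma 6.10 (the path-pair machine).
* S. Arora, B. Barak, *Computational Complexity: A Modern Approach*, CUP 2009, §1.3, §1.4.1
  (composition, clocked loops).
-/

noncomputable section

namespace Literature.Computability.QuantumComplexity

namespace ADH

open _root_.Computability Polynomial Complexity Complexity.Brick Complexity.Plumb Cryptography

variable {N : ℕ}

/-! ### Co-validity of a coin list -/

/-- **Co-validity** of a coin list along a gate list (one coin per gate, read with `headBit`): the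
coin of every Hadamard gate is `0`; the coins of the other gates are free. Exactly `2^{μ - h}` of
the coin blocks of length `μ` are co-valid (`cnt_coValid`). [folklore] -/
def coValid : List (QGate cliffordT N) → List Bool → Bool
  | [], _ => true
  | g :: gs, cs => !(QGateIsH g && headBit cs) && coValid gs cs.tail

/-- The empty gate list accepts every coin list. [folklore] -/
@[simp] theorem coValid_nil (cs : List Bool) : coValid ([] : List (QGate cliffordT N)) cs = true := rfl

/-- One gate. [folklore] -/
theorem coValid_cons (g : QGate cliffordT N) (gs : List (QGate cliffordT N)) (cs : List Bool) :
    coValid (g :: gs) cs = (!(QGateIsH g && headBit cs) && coValid gs cs.tail) := rfl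

/-- **Only the first `μ` coins matter.** [folklore] -/
theorem coValid_append (gs : List (QGate cliffordT N)) :
    ∀ (u y : List Bool), gs.length ≤ u.length → coValid gs (u ++ y) = coValid gs u := by
  induction gs with
  | nil => intro u y _; rfl
  | cons g gs ih =>
    intro u y hu
    cases u with
    | nil => simp at hu
    | cons c u =>
      simp only [List.length_cons, Nat.add_le_add_iff_right] at hu
      simp only [coValid_cons, List.cons_append, headBit_cons, List.tail_cons, ih u y hu]

/-- **The number of co-valid coin blocks is `2^{μ - h}`** (`h = hCount`, the number of Hadamard
gates): the coin of an `H` gate is forced, the coin of any other gate doubles the count.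
[folklore] -/
theorem cnt_coValid (gs : List (QGate cliffordT N)) :
    cnt gs.length {u | coValid gs u = true} = 2 ^ (gs.length - hCount gs) := by
  classical
  induction gs with
  | nil => rw [List.length_nil, cnt_zero]; simp
  | cons g gs ih =>
    have hle := hCount_le_length gs
    rw [List.length_cons, cnt_succ, hCount_cons]
    have h0 : cnt gs.length {y | false :: y ∈ {u | coValid (g :: gs) u = true}} =
        cnt gs.length {u | coValid gs u = true} :=
      cnt_congr fun y _ => by simp [coValid_cons]
    cases hH : QGateIsH g
    · have h1 : cnt gs.length {y | true :: y ∈ {u | coValid (g :: gs) u = true}} =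
          cnt gs.length {u | coValid gs u = true} :=
        cnt_congr fun y _ => by simp [coValid_cons, hH]
      rw [h0, h1, ih]
      simp only [Bool.false_eq_true, if_false, Nat.add_zero]
      rw [Nat.succ_sub hle, pow_succ]
      ring
    · have h1 : cnt gs.length {y | true :: y ∈ {u | coValid (g :: gs) u = true}} =
          cnt gs.length {_y | False} :=
        cnt_congr fun y _ => by simp [coValid_cons, hH]
      rw [h0, h1, ih, cnt_const]
      simp

/-! ### One round of the co-walk -/

/-- The flag after one gate of the co-walk: cleared by a choice bit `1` on an `H` gate (`opF`
empty), kept otherwise. [folklore] -/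
def cvT : List Bool → List Bool := iteFn (nilT opF) v'T vT

/-- The record after one gate of the co-walk: next gate code split off, one coin read, label and
phase untouched, flag updated by `cvT`. [folklore] -/
def coR : List Bool → List Bool := mk6 dF e'F co'F wF phF cvT

/-- **One round of the co-walk**: idle if no gate is ahead, otherwise `coR`.
[cite: AroraBarak2009, §1.3] -/
def coRoundF : List Bool → List Bool := iteFn (nilT eF) idleR coR

/-- `cvT` is in `FP` (composition of bricks). [folklore] -/
theorem cvT_mem_FP : cvT ∈ FP := iteFn_mem_FP (nilT_mem_FP opF_mem_FP) v'T_mem_FP vT_mem_FP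

/-- `coR` is in `FP` (composition of bricks). [folklore] -/
theorem coR_mem_FP : coR ∈ FP :=
  mk6_mem_FP (nthF_mem_FP 0) e'F_mem_FP co'F_mem_FP (nthF_mem_FP 3) (nthF_mem_FP 4) cvT_mem_FP

/-- **`coRoundF ∈ FP`.** [cite: AroraBarak2009, §1.3] -/
theorem coRoundF_mem_FP : coRoundF ∈ FP :=
  iteFn_mem_FP (nilT_mem_FP (nthF_mem_FP 1)) idleR_mem_FP coR_mem_FP

/-- Value of `cvT`, on every string. [folklore] -/
theorem cvT_apply (z : List Bool) :
    cvT z = [decide (vF z = [true]) && !(decide (opF z = []) && headBit (coF z))] := by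
  rw [cvT, iteFn_apply (nilT_apply opF z)]
  by_cases h : opF z = []
  · simp [h, v'T_apply]
  · simp [h, vT_apply]

/-- `coRoundF` as an honest case distinction, on every string. [folklore] -/
theorem coRoundF_eq (z : List Bool) : coRoundF z = if eF z = [] then idleR z else coR z := by
  rw [coRoundF, iteFn_apply (nilT_apply eF z)]
  by_cases h0 : eF z = []
  · simp [h0]
  · rw [if_neg (by simpa using h0), if_neg h0]

/-- Constant growth of `coR`, on every string. [folklore] -/
theorem length_coR_le (z : List Bool) : (coR z).length ≤ z.length + roundGrowth := by
  have hf := length_fields_le z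
  have h1 : (e'F z).length ≤ (eF z).length := by
    have := length_fstF_sndF_le (eF z); simp only [e'F, Function.comp_apply]; omega
  have h2 : (co'F z).length ≤ (coF z).length := by simp [co'F]
  have h5 : (cvT z).length = 1 := by rw [cvT_apply]; rfl
  rw [coR, mk6_apply, length_rec6]
  simp only [roundGrowth]
  omega

/-- **Constant growth**: `|coRoundF z| ≤ |z| + 30` on every string. [folklore] -/
theorem length_coRoundF_le (z : List Bool) : (coRoundF z).length ≤ z.length + roundGrowth := by
  rw [coRoundF_eq]
  split_ifs
  exacts [length_idleR_le z, length_coR_le z]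

/-- **The first field is kept**, on every string. [folklore] -/
theorem fstF_coRoundF (z : List Bool) : fstF (coRoundF z) = fstF z := by
  rw [coRoundF_eq]
  split_ifs <;> simp [idleR, coR, Brick.nthF_zero]

/-! ### The clocked co-walk -/

/-- **The co-walk**: `|d|` rounds of `coRoundF`. [cite: AroraBarak2009, §1.4.1 (clocked loops)] -/
def coPassF : List Bool → List Bool := fun r => coRoundF^[(X : Polynomial ℕ).eval (fstF r).length] r

/-- **`coPassF ∈ FP`** (`iterate_mem_FP_of_growth`). [cite: AroraBarak2009, §1.3, §1.4.1] -/
theorem coPassF_mem_FP : coPassF ∈ FP :=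
  iterate_mem_FP_of_growth coRoundF_mem_FP roundGrowth fstF_coRoundF
    (fun w => (length_coRoundF_le w).trans (by nlinarith [Nat.zero_le (boolUnpair w).1.length])) X

/-! ### One round on a record -/

section RoundSpec

variable (d : List Bool) (l : List (List Bool)) (co : List Bool) (w : QReg N) (ph : List Bool)

/-- One co-round on an `H` gate: the flag is cleared by a coin `1`. [folklore] -/
theorem coRoundF_rec_H (e : Fin (cliffordT.arity CliffordTOp.H) ↪ Fin N) (vb : Bool) :
    coRoundF (rec6 d (encList ((QGate.gate CliffordTOp.H e : QGate cliffordT N).encode :: l)) co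
        (List.ofFn w) ph [vb]) =
      rec6 d (encList l) co.tail (List.ofFn w) ph [vb && !headBit co] := by
  rw [encode_gateH]
  obtain ⟨hE, hop, he', hco', -, hco, -, -, -, hd, hw, hph, hv⟩ :=
    pieces_rec6 d l co w ph [vb] [] [true] [] (embH e 0)
  set z := rec6 d (encList ((false :: boolPair [] (boolPair [true] (boolPair (encodeNat (embH e 0)) []))) :: l))
    co (List.ofFn w) ph [vb] with hz
  have hcv : cvT z = [vb && !headBit co] := by
    rw [cvT_apply, hop, hv, hco]
    cases vb <;> simp
  rw [coRoundF_eq, if_neg hE, coR, mk6_apply, hd, he', hco', hw, hph, hcv]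

/-- One co-round on a gate whose code has a nonempty symbol field (`S`, `T`, `CNOT`): the flag is
kept. [folklore] -/
theorem coRoundF_rec_of_op (op ar rest : List Bool) (hop0 : op ≠ []) (i : Fin N) (vb : Bool) :
    coRoundF (rec6 d (encList ((false :: boolPair op (boolPair ar (boolPair (encodeNat i) rest))) :: l)) co
        (List.ofFn w) ph [vb]) =
      rec6 d (encList l) co.tail (List.ofFn w) ph [vb] := by
  obtain ⟨hE, hop, he', hco', -, hco, -, -, -, hd, hw, hph, hv⟩ :=
    pieces_rec6 d l co w ph [vb] op ar rest i
  set z := rec6 d (encList ((false :: boolPair op (boolPair ar (boolPair (encodeNat i) rest))) :: l))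
    co (List.ofFn w) ph [vb] with hz
  have hcv : cvT z = [vb] := by
    rw [cvT_apply, hop, hv]
    cases vb <;> simp [hop0]
  rw [coRoundF_eq, if_neg hE, coR, mk6_apply, hd, he', hco', hw, hph, hcv]

/-- **One co-round is one co-validity step.** On the record of a walk whose next gate is the
oracle-free gate `g`, `coRoundF` splits the gate off, reads one coin, and clears the flag iff
`g` is a Hadamard gate and the coin is `1`. [folklore] -/
theorem coRoundF_rec (g : QGate cliffordT N) (hg : g.IsOracleFree) (vb : Bool) :
    coRoundF (rec6 d (encList (g.encode :: l)) co (List.ofFn w) ph [vb]) =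
      rec6 d (encList l) co.tail (List.ofFn w) ph [vb && !(QGateIsH g && headBit co)] := by
  cases g with
  | oracle k e => exact absurd hg id
  | gate op e =>
    cases op with
    | H => rw [coRoundF_rec_H d l co w ph e vb]; simp [QGateIsH]
    | S =>
      rw [encode_gateS, coRoundF_rec_of_op d l co w ph [true] [true] [] (by simp) (embS e 0) vb]
      simp [QGateIsH]
    | T =>
      rw [encode_gateT, coRoundF_rec_of_op d l co w ph [false, true] [true] [] (by simp) (embT e 0) vb]
      simp [QGateIsH]
    | CNOT =>
      rw [encode_gateCNOT, coRoundF_rec_of_op d l co w ph [true, true] [true, true]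
        (boolPair (encodeNat (embC e 1)) []) (by simp) (embC e 0) vb]
      simp [QGateIsH]

end RoundSpec

/-! ### The co-walk on a record -/

/-- A record with no gate ahead is fixed by the co-round. [folklore] -/
theorem coRoundF_idle (d co wl ph v : List Bool) : coRoundF (rec6 d [] co wl ph v) = rec6 d [] co wl ph v := by
  have hE : eF (rec6 d [] co wl ph v) = [] := by simp [nthF]
  rw [coRoundF_eq, if_pos hE, idleR, mk6_apply]
  obtain ⟨h0, h1, h2, h3, h4, h5⟩ := fields_rec6 d ph v [] co wl
  rw [h0, h1, h2, h3, h4, h5]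

/-- **Enough co-rounds walk the whole gate list**, consuming one coin per gate and accumulating
the co-validity of the coins in the flag, and then idle. [folklore] -/
theorem iterate_coRoundF (d : List Bool) (w : QReg N) (ph : List Bool) (gs : List (QGate cliffordT N))
    (hgs : ∀ g ∈ gs, g.IsOracleFree) :
    ∀ (k : ℕ) (co : List Bool) (vb : Bool), gs.length ≤ k →
    coRoundF^[k] (rec6 d (encList (gs.map QGate.encode)) co (List.ofFn w) ph [vb]) =
      rec6 d [] (co.drop gs.length) (List.ofFn w) ph [vb && coValid gs co] := by
  induction gs with
  | nil =>
    intro k co vb _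
    simp only [List.map_nil, encList_nil, List.length_nil, List.drop_zero, coValid_nil, Bool.and_true]
    exact Function.iterate_fixed (coRoundF_idle d co _ _ _) k
  | cons g gs ih =>
    intro k co vb hk
    rw [List.length_cons] at hk
    obtain ⟨k, rfl⟩ : ∃ k', k = k' + 1 := Nat.exists_eq_add_one.2 (by omega)
    rw [Function.iterate_succ_apply, List.map_cons,
      coRoundF_rec d (gs.map QGate.encode) co w ph g (hgs g (by simp)) vb,
      ih (fun g' hg' => hgs g' (by simp [hg'])) k co.tail _ (by omega)]
    simp [coValid_cons, List.drop_tail, Bool.and_assoc]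

/-- The co-walk on a record: `coPassF` runs `|d|` rounds. [folklore] -/
theorem coPassF_rec6 (d E co wl ph v : List Bool) :
    coPassF (rec6 d E co wl ph v) = coRoundF^[d.length] (rec6 d E co wl ph v) := by
  simp [coPassF, fstF]

/-! ### The co-walk on `⟨x, y⟩` -/

section Whole

variable (F : QCircuitFamily cliffordT)

/-- **The co-walk** on `⟨x, y⟩`: the clocked co-walk from the first record of `ADHMachine.lean`
(all gates of the `|x|`-th circuit ahead, all coins unread, flag set). [folklore] -/
def co1F : List Bool → List Bool := coPassF ∘ rec1F F

/-- The co-validity flag of `⟨x, y⟩` (one bit). [folklore] -/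
def coFlagF : List Bool → List Bool := vF ∘ co1F F

/-- **Dropping one walk's worth of coins**: `⟨x, y⟩ ↦ ⟨x, y ⇂ μ⟩`, `μ` the number of gates of the
`|x|`-th circuit (the unread coins of the co-walk, re-paired with the input). [folklore] -/
def dropWalkF : List Bool → List Bool := pr fstF (coF ∘ co1F F)

/-- `co1F F` is in `FP` for a uniform family (composition of bricks). [folklore] -/
theorem co1F_mem_FP (hU : F.IsUniform) : co1F F ∈ FP := comp_mem_FP coPassF_mem_FP (rec1F_mem_FP F hU)

/-- `coFlagF F` is in `FP` for a uniform family. [folklore] -/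
theorem coFlagF_mem_FP (hU : F.IsUniform) : coFlagF F ∈ FP := comp_mem_FP (sndPow_mem_FP 4) (co1F_mem_FP F hU)

/-- `dropWalkF F` is in `FP` for a uniform family. [folklore] -/
theorem dropWalkF_mem_FP (hU : F.IsUniform) : dropWalkF F ∈ FP :=
  fanoutFn_mem_FP fstF_mem_FP (comp_mem_FP (nthF_mem_FP 2) (co1F_mem_FP F hU))

/-- **The co-walk on `⟨x, y⟩`**: it leaves the coins `y ⇂ μ` and the flag `coValid`. [folklore] -/
theorem co1F_boolPair (hF : F.IsOracleFree) (x y : List Bool) :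
    co1F F (boolPair x y) =
      rec6 (F.descFn x) [] (y.drop (F.circ x.length).gates.length) (List.ofFn (w₀ F x)) (ones 0)
        [coValid (F.circ x.length).gates y] := by
  simp only [co1F, Function.comp_apply, rec1F_boolPair, coPassF_rec6]
  have h := iterate_coRoundF (F.descFn x) (w₀ F x) (ones 0) _ (gates_isOracleFree F hF x.length)
    (F.descFn x).length y true (length_gates_le_length_descFn F x)
  rw [Bool.true_and] at h
  exact h

/-- **Value of the co-validity flag.** [folklore] -/
theorem coFlagF_boolPair (hF : F.IsOracleFree) (x y : List Bool) :
    coFlagF F (boolPair x y) = [coValid (F.circ x.length).gates y] := by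
  simp only [coFlagF, Function.comp_apply, co1F_boolPair F hF x y]
  simp [sndPow]

/-- **Value of the coin-dropping map**: `⟨x, y⟩ ↦ ⟨x, y ⇂ μ⟩`. [folklore] -/
theorem dropWalkF_boolPair (hF : F.IsOracleFree) (x y : List Bool) :
    dropWalkF F (boolPair x y) = boolPair x (y.drop (F.circ x.length).gates.length) := by
  simp only [dropWalkF, fanoutFn_apply, Function.comp_apply, co1F_boolPair F hF x y, fstF_boolPair]
  simp [nthF]

end Whole

end ADH

end Literature.Computability.QuantumComplexity

end
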